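import Summits.FinalStateConjecture.FinalStateConjecture.Theses.ZeroEnergyKerrOrBomb
import Literature.Geometry.Lorentzian.TrappedZeroEnergyRay

/-!
# `ErgoregionBomb` (crux `stmt-FinalStateConjecture-10691`, route `ZeroEnergyKerrOrBomb`):
# the growth law of a Killing-mode pair along the stationary flow (negative-side support)

Support file of the crux disprover (cdisprove seat), `sorry`-free. The conclusion of the crux (and of
both repairs on the item) asks for a Killing-mode pair `(ψ, χ)` of frequency `ν + iω`, `ν > 0`:
`dψ(T) = νψ − ωχ`, `dχ(T) = ωψ + νχ` on the d.o.c., bounded on `doc ∩ I⁻(far slice region)`.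
Along an integral curve `σ` of the stationary field `T` the real form of `Ψ ∘ φ_t = e^{(ν+iω)t} Ψ`
is the growth law `(ψ² + χ²)(σ t) = e^{2ν(t − t₀)} (ψ² + χ²)(σ t₀)`; consequently a `ν > 0` pair
which is bounded along a FORWARD half-orbit `σ([t₀, ∞))` vanishes there. This is the tightness of
the boundedness clause: the variant of the crux demanding boundedness on the whole d.o.c. has no
non-trivial solution on any hole whose d.o.c. is forward-invariant under the flow
(`modePair_eq_zero_of_bounded_on_doc`), so provers must produce modes unbounded towards the future
and bounded only towards the past of the far slice region.

* `hasDerivAt_comp_integralCurve` — chain rule `(φ ∘ σ)' = dφ(T)` along an integral curve of `T`;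
* `modePair_sq_hasDerivAt`, `modePair_sq_eq_exp` — the growth law, infinitesimal and integrated;
* `modePair_eq_zero_of_bounded_forward_orbit`, `modePair_eq_zero_of_bounded_on_doc` — tightness.
-/

noncomputable section

set_option linter.dupNamespace false

open Bundle Set Filter
open scoped Manifold Topology

namespace Summit.FinalStateConjecture.FinalStateConjecture.Theorems.ErgoregionBomb.Negative

open Literature.Geometry.Lorentzian

variable (𝓑 : StationaryAFBlackHole.{0}) [𝓑.metric.HasLeviCivita]

omit [𝓑.metric.HasLeviCivita] in
/-- Chain rule along an integral curve `σ` of the stationary field: `(φ ∘ σ)'(t) = dφ(T)(σ t)`.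
[folklore] -/
theorem hasDerivAt_comp_integralCurve {σ : ℝ → 𝓑.carrier} (hσ : IsMIntegralCurve σ 𝓑.killing)
    {φ : 𝓑.carrier → ℝ} {t : ℝ} (hφ : MDifferentiableAt (𝓡 4) 𝓘(ℝ, ℝ) φ (σ t)) :
    HasDerivAt (fun s ↦ φ (σ s)) (mfderiv (𝓡 4) 𝓘(ℝ, ℝ) φ (σ t) (𝓑.killing (σ t))) t := by
  set L : ℝ →L[ℝ] ℝ := (mfderiv (𝓡 4) 𝓘(ℝ, ℝ) φ (σ t)).comp
    ((1 : ℝ →L[ℝ] ℝ).smulRight (𝓑.killing (σ t))) with hL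
  have h1 : HasMFDerivAt 𝓘(ℝ, ℝ) 𝓘(ℝ, ℝ) (φ ∘ σ) t L := hφ.hasMFDerivAt.comp t (hσ t)
  have h2 : HasFDerivAt (φ ∘ σ) L t := hasMFDerivAt_iff_hasFDerivAt.mp h1
  have h3 : HasDerivAt (φ ∘ σ) (L 1) t := h2.hasDerivAt
  have hL1 : L 1 = mfderiv (𝓡 4) 𝓘(ℝ, ℝ) φ (σ t) (𝓑.killing (σ t)) := by
    show (mfderiv (𝓡 4) 𝓘(ℝ, ℝ) φ (σ t)) ((1 : ℝ) • 𝓑.killing (σ t)) = _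
    rw [one_smul]
  rw [hL1] at h3
  exact h3

omit [𝓑.metric.HasLeviCivita] in
/-- **Growth law, infinitesimal form.** Along an integral curve `σ` of `T`, a pair satisfying the
Killing eigen-equations `dψ(T) = νψ − ωχ`, `dχ(T) = ωψ + νχ` at `σ t` has
`(ψ² + χ²)∘σ` with derivative `2ν (ψ² + χ²)(σ t)` there (real form of `|Ψ ∘ φ_t| = e^{νt}|Ψ|`).
[folklore] -/
theorem modePair_sq_hasDerivAt {σ : ℝ → 𝓑.carrier} (hσ : IsMIntegralCurve σ 𝓑.killing)
    {ψ χ : 𝓑.carrier → ℝ} {ν ω : ℝ} {t : ℝ}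
    (hψd : MDifferentiableAt (𝓡 4) 𝓘(ℝ, ℝ) ψ (σ t))
    (hχd : MDifferentiableAt (𝓡 4) 𝓘(ℝ, ℝ) χ (σ t))
    (hψ : mfderiv (𝓡 4) 𝓘(ℝ, ℝ) ψ (σ t) (𝓑.killing (σ t)) = ν * ψ (σ t) - ω * χ (σ t))
    (hχ : mfderiv (𝓡 4) 𝓘(ℝ, ℝ) χ (σ t) (𝓑.killing (σ t)) = ω * ψ (σ t) + ν * χ (σ t)) :
    HasDerivAt (fun s ↦ ψ (σ s) ^ 2 + χ (σ s) ^ 2)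
      (2 * ν * (ψ (σ t) ^ 2 + χ (σ t) ^ 2)) t := by
  have h1 := hasDerivAt_comp_integralCurve 𝓑 hσ hψd
  have h2 := hasDerivAt_comp_integralCurve 𝓑 hσ hχd
  rw [hψ] at h1
  rw [hχ] at h2
  have h := (h1.mul h1).add (h2.mul h2)
  beta_reduce at h
  have h' : HasDerivAt (fun s ↦ ψ (σ s) ^ 2 + χ (σ s) ^ 2)
      ((ν * ψ (σ t) - ω * χ (σ t)) * ψ (σ t) + ψ (σ t) * (ν * ψ (σ t) - ω * χ (σ t)) +
        ((ω * ψ (σ t) + ν * χ (σ t)) * χ (σ t) + χ (σ t) * (ω * ψ (σ t) + ν * χ (σ t)))) t := by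
    refine h.congr_of_eventuallyEq (Filter.Eventually.of_forall fun s ↦ ?_)
    simp only [pow_two, Pi.add_apply, Pi.mul_apply]
  refine h'.congr_deriv ?_
  ring

omit [𝓑.metric.HasLeviCivita] in
/-- **Growth law, integrated form**: on an order-connected set `J` of parameters along which the
orbit `σ` stays where the eigen-equations hold (and `ψ, χ` are differentiable),
`(ψ² + χ²)(σ t) = e^{2ν(t − t₀)} (ψ² + χ²)(σ t₀)` for `t, t₀ ∈ J`. [folklore] -/
theorem modePair_sq_eq_exp {σ : ℝ → 𝓑.carrier} (hσ : IsMIntegralCurve σ 𝓑.killing)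
    {ψ χ : 𝓑.carrier → ℝ} {ν ω : ℝ} {J : Set ℝ} (hJ : J.OrdConnected)
    (hd : ∀ t ∈ J, MDifferentiableAt (𝓡 4) 𝓘(ℝ, ℝ) ψ (σ t) ∧
      MDifferentiableAt (𝓡 4) 𝓘(ℝ, ℝ) χ (σ t))
    (heig : ∀ t ∈ J, mfderiv (𝓡 4) 𝓘(ℝ, ℝ) ψ (σ t) (𝓑.killing (σ t)) = ν * ψ (σ t) - ω * χ (σ t) ∧
      mfderiv (𝓡 4) 𝓘(ℝ, ℝ) χ (σ t) (𝓑.killing (σ t)) = ω * ψ (σ t) + ν * χ (σ t))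
    {t₀ t : ℝ} (ht₀ : t₀ ∈ J) (ht : t ∈ J) :
    ψ (σ t) ^ 2 + χ (σ t) ^ 2 =
      Real.exp (2 * ν * (t - t₀)) * (ψ (σ t₀) ^ 2 + χ (σ t₀) ^ 2) := by
  have hF : ∀ s ∈ J, HasDerivAt
      (fun s ↦ Real.exp (-(2 * ν) * s) * (ψ (σ s) ^ 2 + χ (σ s) ^ 2)) 0 s := by
    intro s hs
    have hEs := modePair_sq_hasDerivAt 𝓑 hσ (hd s hs).1 (hd s hs).2 (heig s hs).1 (heig s hs).2
    have hexp : HasDerivAt (fun s ↦ Real.exp (-(2 * ν) * s))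
        (Real.exp (-(2 * ν) * s) * (-(2 * ν))) s := by
      have h := ((hasDerivAt_id s).const_mul (-(2 * ν))).exp
      simpa using h
    have h := hexp.mul hEs
    beta_reduce at h
    refine h.congr_deriv ?_
    ring
  have hconst := apply_eq_apply_of_hasDerivAt_zero hJ hF ht ht₀
  beta_reduce at hconst
  calc ψ (σ t) ^ 2 + χ (σ t) ^ 2
      = Real.exp (2 * ν * t) * (Real.exp (-(2 * ν) * t) * (ψ (σ t) ^ 2 + χ (σ t) ^ 2)) := by
        rw [← mul_assoc, ← Real.exp_add, show 2 * ν * t + -(2 * ν) * t = 0 by ring,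
          Real.exp_zero, one_mul]
    _ = Real.exp (2 * ν * t) * (Real.exp (-(2 * ν) * t₀) * (ψ (σ t₀) ^ 2 + χ (σ t₀) ^ 2)) := by
        rw [hconst]
    _ = Real.exp (2 * ν * (t - t₀)) * (ψ (σ t₀) ^ 2 + χ (σ t₀) ^ 2) := by
        rw [← mul_assoc, ← Real.exp_add,
          show 2 * ν * t + -(2 * ν) * t₀ = 2 * ν * (t - t₀) by ring]

omit [𝓑.metric.HasLeviCivita] in
/-- **Tightness of the boundedness region.** For `ν > 0`, a pair satisfying the eigen-equations along
the FORWARD half `σ([t₀, ∞))` of a `T`-orbit and bounded there vanishes at `σ t₀`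
(`e^{2ν(t−t₀)}(ψ₀² + χ₀²) ≤ 2C²` for all `t ≥ t₀` forces `ψ₀ = χ₀ = 0`). So the conclusion of the crux
can only be met because its bound is imposed on `doc ∩ I⁻(far slice region)`, which contains no
forward-complete `T`-orbit; the strengthening "bounded on the whole d.o.c." kills every growing
mode (next theorem). [folklore] -/
theorem modePair_eq_zero_of_bounded_forward_orbit {σ : ℝ → 𝓑.carrier}
    (hσ : IsMIntegralCurve σ 𝓑.killing) {ψ χ : 𝓑.carrier → ℝ} {ν ω : ℝ} (hν : 0 < ν) {t₀ : ℝ}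
    (hd : ∀ t, t₀ ≤ t → MDifferentiableAt (𝓡 4) 𝓘(ℝ, ℝ) ψ (σ t) ∧
      MDifferentiableAt (𝓡 4) 𝓘(ℝ, ℝ) χ (σ t))
    (heig : ∀ t, t₀ ≤ t → mfderiv (𝓡 4) 𝓘(ℝ, ℝ) ψ (σ t) (𝓑.killing (σ t)) = ν * ψ (σ t) - ω * χ (σ t) ∧
      mfderiv (𝓡 4) 𝓘(ℝ, ℝ) χ (σ t) (𝓑.killing (σ t)) = ω * ψ (σ t) + ν * χ (σ t))
    {C : ℝ} (hb : ∀ t, t₀ ≤ t → |ψ (σ t)| ≤ C ∧ |χ (σ t)| ≤ C) :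
    ψ (σ t₀) = 0 ∧ χ (σ t₀) = 0 := by
  set E₀ := ψ (σ t₀) ^ 2 + χ (σ t₀) ^ 2 with hE₀
  have hE₀nn : 0 ≤ E₀ := by positivity
  have hbound : ∀ t, t₀ ≤ t → Real.exp (2 * ν * (t - t₀)) * E₀ ≤ 2 * C ^ 2 := by
    intro t ht
    rw [← modePair_sq_eq_exp 𝓑 hσ Set.ordConnected_Ici (fun s hs ↦ hd s hs) (fun s hs ↦ heig s hs)
      (Set.mem_Ici.2 le_rfl) (Set.mem_Ici.2 ht)]
    obtain ⟨h1, h2⟩ := hb t ht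
    have h1' : ψ (σ t) ^ 2 ≤ C ^ 2 := by
      simpa only [sq_abs] using pow_le_pow_left₀ (abs_nonneg _) h1 2
    have h2' : χ (σ t) ^ 2 ≤ C ^ 2 := by
      simpa only [sq_abs] using pow_le_pow_left₀ (abs_nonneg _) h2 2
    linarith
  have hE₀z : E₀ = 0 := by
    by_contra hne
    have hpos : 0 < E₀ := lt_of_le_of_ne hE₀nn (Ne.symm hne)
    -- choose `t` with `2ν(t − t₀) = (2C² + 1)/E₀`
    set s : ℝ := (2 * C ^ 2 + 1) / E₀ / (2 * ν) with hs
    have hsnn : 0 ≤ s := by positivity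
    have h := hbound (t₀ + s) (by linarith)
    have hexp : 2 * ν * (t₀ + s - t₀) + 1 ≤ Real.exp (2 * ν * (t₀ + s - t₀)) :=
      Real.add_one_le_exp _
    have hid : 2 * ν * (t₀ + s - t₀) = (2 * C ^ 2 + 1) / E₀ := by
      rw [hs]; field_simp; ring
    rw [hid] at hexp h
    have h3 : ((2 * C ^ 2 + 1) / E₀ + 1) * E₀ ≤ 2 * C ^ 2 :=
      le_trans (mul_le_mul_of_nonneg_right hexp hE₀nn) h
    have h4 : ((2 * C ^ 2 + 1) / E₀ + 1) * E₀ = 2 * C ^ 2 + 1 + E₀ := by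
      field_simp
    linarith
  have hψ0 : ψ (σ t₀) ^ 2 = 0 := by nlinarith [sq_nonneg (ψ (σ t₀)), sq_nonneg (χ (σ t₀))]
  have hχ0 : χ (σ t₀) ^ 2 = 0 := by nlinarith [sq_nonneg (ψ (σ t₀)), sq_nonneg (χ (σ t₀))]
  exact ⟨pow_eq_zero_iff (n := 2) (by norm_num) |>.mp hψ0,
    pow_eq_zero_iff (n := 2) (by norm_num) |>.mp hχ0⟩

/-- **The strengthening "bounded on the whole d.o.c." has no non-trivial solution** on any hole whose
d.o.c. is forward-invariant under the stationary flow (hypothesis `hinv`; classically automatic: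
`φ_t` are time-orientation preserving isometries fixing `M_ext`): a `ν > 0` Killing-mode pair,
smooth near the d.o.c. and bounded on ALL of `𝓑.doc`, vanishes on `𝓑.doc`. Hence the variant of
the crux with `doc ∩ I⁻(far slice region)` replaced by `doc` in the boundedness clause has an
unsatisfiable conclusion and collapses to the rigidity-type statement "no telescope hole has a
trapped zero-energy ray". [folklore] -/
theorem modePair_eq_zero_of_bounded_on_doc
    (hinv : ∀ σ : ℝ → 𝓑.carrier, IsMIntegralCurve σ 𝓑.killing → σ 0 ∈ 𝓑.doc →
      ∀ t : ℝ, 0 ≤ t → σ t ∈ 𝓑.doc)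
    {ν ω : ℝ} {ψ χ : 𝓑.carrier → ℝ} (hν : 0 < ν)
    (hU : ∃ U : Set 𝓑.carrier, IsOpen U ∧ 𝓑.doc ∪ 𝓑.horizon ⊆ U ∧
      ContMDiffOn (𝓡 4) 𝓘(ℝ, ℝ) ((⊤ : ℕ∞) : WithTop ℕ∞) ψ U ∧
      ContMDiffOn (𝓡 4) 𝓘(ℝ, ℝ) ((⊤ : ℕ∞) : WithTop ℕ∞) χ U)
    (heig : ∀ x ∈ 𝓑.doc, mfderiv (𝓡 4) 𝓘(ℝ, ℝ) ψ x (𝓑.killing x) = ν * ψ x - ω * χ x ∧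
      mfderiv (𝓡 4) 𝓘(ℝ, ℝ) χ x (𝓑.killing x) = ω * ψ x + ν * χ x)
    (hb : ∃ C : ℝ, ∀ x ∈ 𝓑.doc, |ψ x| ≤ C ∧ |χ x| ≤ C) :
    ∀ x ∈ 𝓑.doc, ψ x = 0 ∧ χ x = 0 := by
  intro x hx
  obtain ⟨U, hUo, hsub, hψ, hχ⟩ := hU
  obtain ⟨C, hC⟩ := hb
  obtain ⟨σ, hσ, hσ0⟩ := 𝓑.isStationaryKilling.isCompleteVectorField x
  have hdoc : ∀ t, 0 ≤ t → σ t ∈ 𝓑.doc := hinv σ hσ (hσ0 ▸ hx)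
  have hdiff : ∀ t, (0 : ℝ) ≤ t → MDifferentiableAt (𝓡 4) 𝓘(ℝ, ℝ) ψ (σ t) ∧
      MDifferentiableAt (𝓡 4) 𝓘(ℝ, ℝ) χ (σ t) := by
    intro t ht
    have hmem : U ∈ 𝓝 (σ t) := hUo.mem_nhds (hsub (Or.inl (hdoc t ht)))
    exact ⟨(hψ.contMDiffAt hmem).mdifferentiableAt (by simp),
      (hχ.contMDiffAt hmem).mdifferentiableAt (by simp)⟩
  have h := modePair_eq_zero_of_bounded_forward_orbit 𝓑 hσ hν (t₀ := 0) hdiff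
    (fun t ht ↦ heig (σ t) (hdoc t ht)) (fun t ht ↦ hC (σ t) (hdoc t ht))
  rwa [hσ0] at h


end Summit.FinalStateConjecture.FinalStateConjecture.Theorems.ErgoregionBomb.Negative

end
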